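import Mathlib
import Summits.RiemannHypothesis.RiemannHypothesis.Theorems.HandoffRealZeroCount
import Summits.RiemannHypothesis.RiemannHypothesis.Theorems.HandoffXiZeroCount
import Summits.RiemannHypothesis.RiemannHypothesis.Theorems.HandoffCountThinConverse
import Literature.NumberTheory.LFunctions.RiemannXiProofs
import Literature.NumberTheory.LFunctions.ZetaZerosProofs
import Literature.NumberTheory.DiophantineGeometry.NamedHypothesesProofs
import Literature.Analysis.Complex.FourierPolyaKiKimEngine
import HarnessLib

/-!
# ROUTE R-K «COUNT-AND-THIN»: near-axis convergence PINS the count to `N₀(T)` (RH-free); SC-2 per window ⟺ RH up to `T`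

Handoff track (ROUTE 1′), prove-1 gen13; companion of `HandoffCountThinConverse.lean` /
`HandoffCountThinWindow.lean` (idea-3 gen22 ROUTE R-K; HOME/handoff/IDEAS-finite-rank.md v3.3.1
§G22-3). Built imports only.

THE SHARP RH-FREE FORM of «what the count law measures». Assume only that the zeros of `ζ` ON THE
CRITICAL LINE with `0 < Im ρ ≤ T` are simple (stated on the `Ξ` side: real zeros of `Ξ` in `(0, T]`
have analytic order `1`; RH-free, and certified far beyond every census height). Then for any family
of entire, real-on-`ℝ` functions `û_t` with real normalisers `c_t ≠ 0` such that `c_t û_t → Ξ`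
locally uniformly on an open `U ⊇ [0, T]`, `T` not an ordinate:

* ★ `encard_realZeros_eq_criticalZeroCount_of_nhds` — eventually
  `#{x ∈ (0, T] : û_t(x) = 0} = N₀(T)` (`criticalZeroCount T`): the count is PINNED to the number of
  critical zeros (lower: sign changes at simple real zeros survive; upper: Rolle).
* ★ `count_iff_riemannHypothesisUpTo_of_nhds` — hence SC-2 at `T` (eventually `# = N(T)`) holds IFF
  `RiemannHypothesisUpTo T` (every zero with `0 < Im ρ ≤ T` on the line): given THIN and simple
  critical zeros, the count law at `T` IS «RH up to height T» — the conjecture SC-2 measures exactly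
  the off-line zeros, window by window.
Nothing here is, or suggests, a proof of RH.
-/

set_option linter.dupNamespace false  -- the mandated namespace repeats `RiemannHypothesis`

noncomputable section

open Filter Set Topology Metric Complex
open scoped BigOperators
open Literature.NumberTheory.LFunctions Literature.Analysis.Complex.KiKim
open Literature.NumberTheory.DiophantineGeometry (RiemannHypothesisUpTo riemannHypothesisUpTo_iff_criticalZeroCount_eq)

namespace Summit.RiemannHypothesis.RiemannHypothesis.Theorems

namespace CountThin

open RealZeroCount

/-- ★ **RH-FREE PINNING.** If the real zeros of `Ξ` in `(0, T]` have analytic order one (the critical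
zeros of `ζ` up to height `T` are simple), `û_t = F t` are entire and real on `ℝ`, `c_t ≠ 0` real with
`c_t û_t → Ξ` locally uniformly on an open `U ⊇ [0, T]`, and `T` is not an ordinate, then eventually
`#{x ∈ (0, T] : û_t(x) = 0} = N₀(T) = criticalZeroCount T`. -/
theorem encard_realZeros_eq_criticalZeroCount_of_nhds {T : ℝ}
    (hsimple : ∀ z : ℂ, riemannXiUpper z = 0 → z.im = 0 → 0 < z.re → z.re ≤ T →
      analyticOrderNatAt riemannXiUpper z = 1)
    {F : ℝ → ℂ → ℂ} (hdiff : ∀ t, Differentiable ℂ (F t))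
    (hreal : ∀ (t : ℝ) (x : ℝ), (F t x).im = 0) {c : ℝ → ℝ} (hc : ∀ t, c t ≠ 0)
    (hTord : ∀ z : ℂ, riemannXiUpper z = 0 → z.re ≠ T)
    {U : Set ℂ} (hUo : IsOpen U) (hseg : ∀ x ∈ Icc (0 : ℝ) T, (x : ℂ) ∈ U)
    (hloc : TendstoLocallyUniformlyOn (fun t z => ((c t : ℝ) : ℂ) * F t z) riemannXiUpper atTop U) :
    ∀ᶠ t : ℝ in atTop,
      {x : ℝ | 0 < x ∧ x ≤ T ∧ F t x = 0}.encard = (criticalZeroCount T : ℕ∞) := by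
  classical
  set Φ : ℝ → ℂ → ℂ := fun t z => ((c t : ℝ) : ℂ) * F t z with hΦ
  have hΦd : ∀ t, Differentiable ℂ (Φ t) := fun t => (differentiable_const _).mul (hdiff t)
  set g : ℝ → ℝ := fun x => (riemannXiUpper x).re with hg
  set G : ℝ → ℝ → ℝ := fun t x => (Φ t x).re with hG
  set B := (xiZeros_finite T).toFinset with hB
  set Br := B.filter (fun z => z.im = 0) with hBr
  set Z : Finset ℝ := Br.image Complex.re with hZ
  set k : ℝ → ℕ := fun c => analyticOrderNatAt riemannXiUpper (c : ℂ) with hk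
  have hΞreal := im_riemannXiUpper_ofReal_holds
  have hΞd := differentiable_riemannXiUpper'
  have hBrmem : ∀ z ∈ Br, (riemannXiUpper z = 0 ∧ 0 < z.re ∧ z.re ≤ T) ∧ z.im = 0 := fun z hz => by
    obtain ⟨hzB, hz0⟩ := Finset.mem_filter.mp hz
    exact ⟨(Set.Finite.mem_toFinset (xiZeros_finite T)).mp hzB, hz0⟩
  have hBre : ∀ z ∈ Br, ((z.re : ℝ) : ℂ) = z := fun z hz =>
    Complex.ext (by simp) (by simp [(hBrmem z hz).2])
  have hZmem : ∀ c ∈ Z, riemannXiUpper c = 0 ∧ 0 < c ∧ c < T := by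
    intro c hc
    obtain ⟨z, hz, rfl⟩ := Finset.mem_image.mp hc
    obtain ⟨⟨hz0, hzpos, hzT⟩, -⟩ := hBrmem z hz
    refine ⟨by rw [hBre z hz]; exact hz0, hzpos, lt_of_le_of_ne hzT (hTord z hz0)⟩
  have hone : ∀ c ∈ Z, k c = 1 := by
    intro c hc
    obtain ⟨hc0, hcpos, hcT⟩ := hZmem c hc
    exact hsimple c hc0 (by simp) (by simpa using hcpos) (by simpa using hcT.le)
  -- `N₀(T) = #Z` (all real zeros up to `T` being simple): the bridge `z ↦ 1/2 + iz`
  have hcardZ : Z.card = criticalZeroCount T := by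
    have hcard : Z.card = Br.card := Finset.card_image_of_injOn fun z hz w hw h =>
      Complex.ext h (by rw [(hBrmem z (by simpa using hz)).2, (hBrmem w (by simpa using hw)).2])
    have hfinC : {ρ ∈ zetaZeroBox (1 / 2) T | ρ.re = 1 / 2}.Finite :=
      (zetaZeroBox_finite (1 / 2) T).subset (sep_subset _ _)
    have hN : (criticalZeroCount T : ℤ) = ∑ ρ ∈ hfinC.toFinset, riemannZetaZeroOrder ρ := by
      rw [criticalZeroCount, finsum_mem_eq_finite_toFinset_sum _ hfinC]
      refine Int.toNat_of_nonneg (Finset.sum_nonneg fun ρ hρ => ?_)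
      exact riemannZetaZeroOrder_nonneg_of_mem_zetaZeroBox ((Set.Finite.mem_toFinset _).mp hρ).1
    have hsum : ((Br.card : ℕ) : ℤ) = ∑ ρ ∈ hfinC.toFinset, riemannZetaZeroOrder ρ := by
      rw [Finset.card_eq_sum_ones, Nat.cast_sum]
      refine Finset.sum_nbij' (fun z => 1 / 2 + I * z) (fun ρ => -I * (ρ - 1 / 2)) ?_ ?_ ?_ ?_ ?_
      · intro z hz
        obtain ⟨⟨hΞ, h0, hT⟩, hz0⟩ := hBrmem z hz
        obtain ⟨hζ, -, -⟩ := zeta_zero_of_riemannXiUpper_eq_zero hΞ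
        have hre : (1 / 2 + I * z).re = 1 / 2 := by rw [re_half_add_I_mul, hz0, sub_zero]
        refine (Set.Finite.mem_toFinset _).mpr ⟨⟨hζ, hre.symm.le, by rw [hre]; norm_num, ?_, ?_⟩, hre⟩
        · rw [im_half_add_I_mul]; exact h0
        · rw [im_half_add_I_mul]; exact hT
      · intro ρ hρ
        obtain ⟨⟨hζ, -, -, him0, himT⟩, hre⟩ := (Set.Finite.mem_toFinset _).mp hρ
        obtain ⟨h0, h1⟩ := re_mem_Ioo_of_riemannZeta_eq_zero_of_im_ne_zero hζ him0.ne'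
        refine Finset.mem_filter.mpr ⟨(Set.Finite.mem_toFinset _).mpr ⟨?_, ?_, ?_⟩, ?_⟩
        · have hρ' : (1 / 2 : ℂ) + I * (-I * (ρ - 1 / 2)) = ρ := by
            have : I * I = -1 := Complex.I_mul_I
            linear_combination (-(ρ - 1 / 2)) * this
          rw [riemannXiUpper, hρ']
          exact (riemannXi_eq_zero_iff_holds ρ).mpr ⟨hζ, h0, h1⟩
        · simpa using him0
        · simpa using himT
        · simp [hre]
      · intro z _
        have : I * I = -1 := Complex.I_mul_I
        linear_combination -z * this
      · intro ρ _
        have : I * I = -1 := Complex.I_mul_I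
        linear_combination (-(ρ - 1 / 2)) * this
      · intro z hz
        obtain ⟨⟨hΞ, h0', hT'⟩, hz0⟩ := hBrmem z hz
        obtain ⟨-, h0, h1⟩ := zeta_zero_of_riemannXiUpper_eq_zero hΞ
        have h1' : analyticOrderNatAt riemannXiUpper z = 1 := hsimple z hΞ hz0 h0' hT'
        have := analyticOrderNatAt_riemannXiUpper_eq h0 h1
        rw [h1'] at this
        exact_mod_cast this
    have := hsum.trans hN.symm
    rw [hcard]; exact_mod_cast this
  have hsumZ : ∑ c ∈ Z, k c = criticalZeroCount T := by
    rw [← hcardZ, Finset.card_eq_sum_ones]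
    exact Finset.sum_congr rfl fun c hc => hone c hc
  -- UPPER COUNT (Rolle)
  have hgzero : ∀ x ∈ Icc (0 : ℝ) T, g x = 0 → x ∈ Z := by
    intro x hx hgx
    have hΞx : riemannXiUpper x = 0 := Complex.ext (by simpa [g] using hgx) (by simpa using hΞreal x)
    have hx0 : 0 < x := by
      rcases hx.1.eq_or_lt with h | h
      · exact absurd (show (x : ℂ).re = 0 by simp [← h]) (re_ne_zero_of_riemannXiUpper_eq_zero hΞx)
      · exact h
    refine Finset.mem_image.mpr ⟨(x : ℂ), Finset.mem_filter.mpr ⟨?_, by simp⟩, by simp⟩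
    exact (Set.Finite.mem_toFinset _).mpr ⟨hΞx, by simpa using hx0, by simpa using hx.2⟩
  have hG0 : TendstoUniformlyOn G g atTop (Icc 0 T) := by
    have := tendstoUniformlyOn_re_iteratedDeriv hUo hΦd hloc hseg 0
    simp only [iteratedDeriv_zero] at this
    exact this
  have hupper : ∀ᶠ t : ℝ in atTop, {x | x ∈ Icc (0 : ℝ) T ∧ G t x = 0}.Finite ∧
      {x | x ∈ Icc (0 : ℝ) T ∧ G t x = 0}.ncard ≤ ∑ c ∈ Z, k c := by
    refine eventually_ncard_zeros_le (N := Z.sup k)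
      (contDiff_re_ofReal (n := 0) hΞd).continuous
      hgzero ?_ ?_ (fun c hc => Finset.le_sup hc) (Eventually.of_forall fun t => contDiff_re_ofReal (hΦd t))
      hG0 ?_
    · intro c _
      exact ((contDiff_re_ofReal (n := ⊤) hΞd).continuous_iteratedDeriv
        (k c) (by exact_mod_cast le_top)).continuousAt
    · intro c _
      rw [iteratedDeriv_re_ofReal hΞd]
      have him := im_iteratedDeriv_ofReal_eq_zero hΞd hΞreal (k c) c
      exact fun h => iteratedDeriv_analyticOrderNatAt_ne_zero (c : ℂ)
        (Complex.ext (by simpa using h) (by simpa using him))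
    · intro c _
      have := tendstoUniformlyOn_re_iteratedDeriv hUo hΦd hloc hseg (k c)
      rw [iteratedDeriv_re_ofReal hΞd]
      refine this.congr (Eventually.of_forall fun t => ?_)
      intro x _
      change (iteratedDeriv (k c) (Φ t) x).re = iteratedDeriv (k c) (fun y : ℝ => (Φ t y).re) x
      rw [iteratedDeriv_re_ofReal (hΦd t)]
  -- LOWER COUNT (sign changes): a common half-width `η` for all zeros
  have hder : ∀ c ∈ Z, HasDerivAt g (deriv riemannXiUpper c).re c ∧ (deriv riemannXiUpper c).re ≠ 0 := by
    intro c hc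
    refine ⟨hasDerivAt_re_ofReal (hΞd.differentiableAt), ?_⟩
    have h1 : analyticOrderNatAt riemannXiUpper c = 1 := hone c hc
    have hne := iteratedDeriv_analyticOrderNatAt_ne_zero (c : ℂ)
    rw [h1, iteratedDeriv_one] at hne
    have him : (deriv riemannXiUpper c).im = 0 := by
      simpa [iteratedDeriv_one] using im_iteratedDeriv_ofReal_eq_zero hΞd hΞreal 1 c
    exact fun h => hne (Complex.ext (by simpa using h) (by simpa using him))
  have hη : ∃ η : ℝ, 0 < η ∧ (∀ c ∈ Z, g (c - η) * g (c + η) < 0) ∧ (∀ c ∈ Z, η < c ∧ c + η < T) ∧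
      ∀ c ∈ Z, ∀ c' ∈ Z, c ≠ c' → 2 * η < |c - c'| := by
    have e1 : ∀ᶠ η : ℝ in 𝓝[>] 0, ∀ c ∈ Z, g (c - η) * g (c + η) < 0 :=
      (Z.eventually_all).mpr fun c hc =>
        eventually_sign_change_of_hasDerivAt (hder c hc).1 (by
          have := (hZmem c hc).1
          simp [g, this]) (hder c hc).2
    have e2 : ∀ᶠ η : ℝ in 𝓝[>] 0, ∀ c ∈ Z, η < c ∧ c + η < T :=
      (Z.eventually_all).mpr fun c hc => by
        have h1 : ∀ᶠ η : ℝ in 𝓝 0, η < c := eventually_lt_nhds (hZmem c hc).2.1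
        have h2 : ∀ᶠ η : ℝ in 𝓝 0, η < T - c := eventually_lt_nhds (by linarith [(hZmem c hc).2.2])
        filter_upwards [nhdsWithin_le_nhds h1, nhdsWithin_le_nhds h2] with η a b
        exact ⟨a, by linarith⟩
    have e3 : ∀ᶠ η : ℝ in 𝓝[>] 0, ∀ c ∈ Z, ∀ c' ∈ Z, c ≠ c' → 2 * η < |c - c'| :=
      (Z.eventually_all).mpr fun c _ => (Z.eventually_all).mpr fun c' _ => by
        by_cases hcc : c = c'
        · exact Eventually.of_forall fun _ h => absurd hcc h
        · have hev : ∀ᶠ η : ℝ in 𝓝 0, 2 * η < |c - c'| := by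
            have hpos : 0 < |c - c'| := abs_pos.mpr (sub_ne_zero.mpr hcc)
            have hcont : Tendsto (fun η : ℝ => 2 * η) (𝓝 0) (𝓝 (2 * 0)) :=
              (continuous_const.mul continuous_id).tendsto (0 : ℝ)
            rw [mul_zero] at hcont
            exact hcont.eventually (eventually_lt_nhds hpos)
          have hev' : ∀ᶠ η : ℝ in 𝓝[>] 0, 2 * η < |c - c'| := nhdsWithin_le_nhds hev
          exact hev'.mono fun _ h _ => h
    obtain ⟨η, ⟨h1, h2, h3⟩, hη0⟩ :=
      ((e1.and (e2.and e3)).and self_mem_nhdsWithin).exists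
    exact ⟨η, hη0, h1, h2, h3⟩
  obtain ⟨η, hη0, hsign, hloc', hsep⟩ := hη
  have hlower : ∀ᶠ t : ℝ in atTop, ∀ c ∈ Z, ∃ x ∈ Ioo (c - η) (c + η), G t x = 0 := by
    refine (Z.eventually_all).mpr fun c hc => ?_
    refine eventually_exists_zero_of_sign_change hη0 ?_ (hsign c hc)
      (Eventually.of_forall fun t => (contDiff_re_ofReal (n := 0) (hΦd t)).continuous) hG0
    intro x hx
    exact ⟨by linarith [hx.1, (hloc' c hc).1], by linarith [hx.2, (hloc' c hc).2]⟩
  -- COMBINE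
  filter_upwards [hupper, hlower] with t ⟨hfin, hle⟩ hlow
  choose! x hxI hx0 using hlow
  set A : Set ℝ := {x : ℝ | 0 < x ∧ x ≤ T ∧ F t x = 0} with hA
  have hGF : ∀ y : ℝ, G t y = 0 → F t y = 0 := by
    intro y hy
    have h1 : (Φ t y).re = 0 := hy
    have h2 : c t * (F t y).re = 0 := by
      have : (Φ t y).re = c t * (F t y).re := by
        show ((((c t : ℝ) : ℂ)) * F t y).re = _
        rw [Complex.re_ofReal_mul]
      rw [← this]; exact h1
    have h3 : (F t y).re = 0 := by
      rcases mul_eq_zero.mp h2 with h | h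
      · exact absurd h (hc t)
      · exact h
    exact Complex.ext (by simpa using h3) (by simpa using hreal t y)
  have hsub : A ⊆ {x | x ∈ Icc (0 : ℝ) T ∧ G t x = 0} := by
    rintro y ⟨hy0, hyT, hFy⟩
    exact ⟨⟨hy0.le, hyT⟩, by simp [G, Φ, hFy]⟩
  have hup : A.encard ≤ (criticalZeroCount T : ℕ∞) := by
    have hle' : {x | x ∈ Icc (0 : ℝ) T ∧ G t x = 0}.ncard ≤ criticalZeroCount T := hsumZ ▸ hle
    refine (Set.encard_le_encard hsub).trans ?_
    rw [← hfin.cast_ncard_eq]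
    exact_mod_cast hle'
  have hinj : Set.InjOn x (Z : Set ℝ) := by
    intro c hc c' hc' hxx
    by_contra hne
    have h1 := hxI c hc
    have h2 := hxI c' hc'
    rw [hxx] at h1
    have : |c - c'| < 2 * η := by
      rw [abs_lt]; constructor <;> linarith [h1.1, h1.2, h2.1, h2.2]
    linarith [hsep c hc c' hc' hne]
  have himage : x '' (Z : Set ℝ) ⊆ A := by
    rintro _ ⟨c, hc, rfl⟩
    have hc' : c ∈ Z := hc
    exact ⟨by linarith [(hxI c hc').1, (hloc' c hc').1], by linarith [(hxI c hc').2, (hloc' c hc').2],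
      hGF _ (hx0 c hc')⟩
  have hlow : (criticalZeroCount T : ℕ∞) ≤ A.encard := by
    rw [← hcardZ, ← Set.encard_coe_eq_coe_finsetCard, ← hinj.encard_image]
    exact Set.encard_le_encard himage
  exact le_antisymm hup hlow

/-- ★ **Per window, SC-2 ⟺ RH up to `T`.** Under the hypotheses of
`encard_realZeros_eq_criticalZeroCount_of_nhds` (simple critical zeros up to `T`, near-axis
convergence, `T` not an ordinate): SC-2 at `T` — eventually `#{x ∈ (0, T] : û_t(x) = 0} = N(T)` —
holds if and only if `RiemannHypothesisUpTo T` (every zero of `ζ` with `0 < Im ρ ≤ T` lies on the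
critical line). Given THIN, the count law at a window IS numerical RH at that window. -/
theorem count_iff_riemannHypothesisUpTo_of_nhds {T : ℝ}
    (hsimple : ∀ z : ℂ, riemannXiUpper z = 0 → z.im = 0 → 0 < z.re → z.re ≤ T →
      analyticOrderNatAt riemannXiUpper z = 1)
    {F : ℝ → ℂ → ℂ} (hdiff : ∀ t, Differentiable ℂ (F t))
    (hreal : ∀ (t : ℝ) (x : ℝ), (F t x).im = 0) {c : ℝ → ℝ} (hc : ∀ t, c t ≠ 0)
    (hTord : ∀ z : ℂ, riemannXiUpper z = 0 → z.re ≠ T)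
    {U : Set ℂ} (hUo : IsOpen U) (hseg : ∀ x ∈ Icc (0 : ℝ) T, (x : ℂ) ∈ U)
    (hloc : TendstoLocallyUniformlyOn (fun t z => ((c t : ℝ) : ℂ) * F t z) riemannXiUpper atTop U) :
    (∀ᶠ t : ℝ in atTop, {x : ℝ | 0 < x ∧ x ≤ T ∧ F t x = 0}.encard = (zetaZeroCount T : ℕ∞)) ↔
      RiemannHypothesisUpTo T := by
  have hpin := encard_realZeros_eq_criticalZeroCount_of_nhds hsimple hdiff hreal hc hTord hUo hseg hloc
  rw [riemannHypothesisUpTo_iff_criticalZeroCount_eq]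
  constructor
  · intro h
    obtain ⟨t, h1, h2⟩ := (hpin.and h).exists
    have : (criticalZeroCount T : ℕ∞) = (zetaZeroCount T : ℕ∞) := h1.symm.trans h2
    exact_mod_cast this
  · intro h
    filter_upwards [hpin] with t ht
    rw [ht]; exact_mod_cast h

/-! Axiom census (expected `propext`, `Classical.choice`, `Quot.sound`). -/
#print axioms count_iff_riemannHypothesisUpTo_of_nhds

end CountThin

end Summit.RiemannHypothesis.RiemannHypothesis.Theorems

end
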